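import Literature.MathematicalPhysics.QuantumManyBody.BoseGasWallCutoff
import Literature.MathematicalPhysics.QuantumManyBody.MarginalSturmWronskian
import HarnessLib

/-!
# Route `BECTangentRigidity`, crux `RigidMomentumBound` (stmt-AtomisticToContinuum-13034):
# stub `stub_fullSliceEnergy1D` — the near-wall bound on the full slice energy

Pure one-dimensional real analysis, no Bose-gas objects. Coordinates: a Dirichlet wall at
`s = 0`, the box extends to `S ≥ s₁ > 0`. Data: the marginal mass `m ≥ 0` (continuous on
`[0, S]`, `m = ∫₀ p`), the normal slice kinetic energy `et ≥ 0` and the full slice energy `e ≥ et`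
(integrable), the Cauchy–Schwarz relation `p² ≤ 4 m·et` a.e., the local virial identity
`∫₀^S g e + ½ ∫₀^S g' p = E' ∫₀^S g m` for every `C¹` test function `g`, and the linear bound
`∫₀^σ et ≤ A σ` for `0 < σ ≤ s₁`. Conclusion: `∫₀^σ e ≤ 12 A σ + 32 E' A σ³` whenever
`0 < σ` and `2σ ≤ s₁`.

Proof.
1. `abs_le_div_add_mul_of_sq_le`: pointwise, `p² ≤ 4 m·et` gives `|p| ≤ m/c + c·et` for every
   `c > 0` (the square of the right-hand side exceeds `4 m·et` by a square).
2. `marginalMass_le`: for `0 < τ ≤ S` and `x ∈ [0, τ]`, `m x ≤ 4τ ∫₀^τ et`. Indeed at a maximum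
   point `z` of `m` on `[0, τ]` (value `B`), `B = ∫₀^z p ≤ ∫₀^z (m/(2τ) + 2τ·et) ≤ B/2 + 2τ∫₀^τ et`.
3. Test the virial identity with the `C¹` wall profile `θ` of `BoseGasWallCutoff` (`1` on
   `(-∞, σ]`, `0` on `[2σ, ∞)`, values in `[0, 1]`, `|θ'| ≤ π/(2σ)`, `θ' = 0` off `(σ, 2σ)`):
   `∫₀^σ e ≤ ∫₀^S θ e = E' ∫₀^S θ m - ½ ∫₀^S θ' p`; with `K = ∫₀^{2σ} et ≤ 2Aσ` and `m ≤ 8σK` on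
   `[0, 2σ]` (step 2), `∫₀^S θ m ≤ 2σ · 8σK` and
   `-∫₀^S θ' p ≤ (π/(2σ)) ∫_σ^{2σ} (8σK/(4σ) + 4σ·et) ≤ 3πK`, so
   `∫₀^σ e ≤ 16 E' σ² K + (3π/2) K ≤ 32 E' A σ³ + 12 A σ` (`π ≤ 4`).

On the model `m = s²`, `p = 2s`, `et = e = 1`, `E' = 0`, `A = 1` every hypothesis holds and the
claim reads `σ ≤ 12σ`. Only Mathlib's interval-integral API, the wall profile of
`Literature/MathematicalPhysics/QuantumManyBody/BoseGasWallCutoff.lean` and the bookkeeping lemma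
`MarginalSturm.integral_eq_integral_of_forall_not_mem_Ioo` are used; the hypotheses `m 0 = 0` and
`0 < s₁` of the registered signature are not needed.
-/

noncomputable section

namespace Summit.AtomisticToContinuum.BoseEinsteinCondensation.Theorems.RigidMomentumBound

open MeasureTheory Set intervalIntegral Real
open Literature.MathematicalPhysics.QuantumManyBody.BoseGas

/-- **Pointwise Cauchy–Schwarz in AM–GM form.** If `q² ≤ 4ab` with `a, b ≥ 0`, then
`|q| ≤ a/c + c·b` for every `c > 0` (since `(a/c + cb)² = 4ab + (a/c - cb)²`). -/
theorem abs_le_div_add_mul_of_sq_le {q a b c : ℝ} (ha : 0 ≤ a) (hb : 0 ≤ b) (hc : 0 < c)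
    (h : q ^ 2 ≤ 4 * a * b) : |q| ≤ a / c + c * b := by
  refine abs_le_of_sq_le_sq ?_ (by positivity)
  have key : (a / c + c * b) ^ 2 = 4 * a * b + (a / c - c * b) ^ 2 := by
    field_simp
    ring
  rw [key]
  linarith [sq_nonneg (a / c - c * b)]

/-- **The `C¹` ramp.** For `σ > 0` there is a `C¹` function `θ : ℝ → [0, 1]` with `θ = 1` on
`(-∞, σ]`, `θ = 0` on `[2σ, ∞)`, `|θ'| ≤ π/(2σ)` everywhere and `θ' = 0` off `(σ, 2σ)`: the wall
profile `t ↦ (1 + cos(π · max 0 (min 1 ((t - σ)/σ))))/2` of `BoseGasWallCutoff`. -/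
theorem exists_ramp {σ : ℝ} (hσ : 0 < σ) :
    ∃ θ : ℝ → ℝ, ContDiff ℝ 1 θ ∧ (∀ t, 0 ≤ θ t ∧ θ t ≤ 1) ∧
      (∀ t, |deriv θ t| ≤ π / (2 * σ)) ∧ (∀ t, t ∉ Ioo σ (2 * σ) → deriv θ t = 0) ∧
      (∀ t, t ≤ σ → θ t = 1) ∧ (∀ t, 2 * σ ≤ t → θ t = 0) := by
  refine ⟨fun x => (1 + cos (π * max 0 (min 1 ((x - σ) / σ)))) / 2,
    WallCutoff.contDiff_wallProfile hσ, fun t => WallCutoff.wallProfile_mem σ σ t, fun t => ?_,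
    fun t ht => ?_, fun t ht => WallCutoff.wallProfile_of_le hσ ht,
    fun t ht => WallCutoff.wallProfile_of_ge hσ (by linarith)⟩
  · rw [WallCutoff.deriv_wallProfile hσ]
    exact WallCutoff.abs_wallProfileDeriv_le hσ σ t
  · rw [WallCutoff.deriv_wallProfile hσ]
    rcases le_or_gt t σ with h | h
    · exact WallCutoff.wallProfileDeriv_of_le hσ h
    · have h' : ¬ t < 2 * σ := fun h' => ht ⟨h, h'⟩
      exact WallCutoff.wallProfileDeriv_of_ge hσ (by linarith [not_lt.1 h'])

/-- **Mass bound from the wall.** Let `0 < τ ≤ S`, `m ≥ 0` continuous on `[0, S]` with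
`m = ∫₀ p` there, `p, et` integrable on `[0, S]`, and `0 ≤ et`, `p² ≤ 4 m·et` a.e. on `[0, S]`.
Then `m x ≤ 4τ ∫₀^τ et` for every `x ∈ [0, τ]`. Proof: at a maximum point `z` of `m` on `[0, τ]`
with value `B`, `B = ∫₀^z p ≤ ∫₀^z (m/(2τ) + 2τ·et) ≤ B/2 + 2τ ∫₀^τ et`. -/
theorem marginalMass_le {S τ : ℝ} {m p et : ℝ → ℝ} (hτ : 0 < τ) (hτS : τ ≤ S)
    (hmc : ContinuousOn m (Icc 0 S)) (hmnn : ∀ s ∈ Icc 0 S, 0 ≤ m s)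
    (hpi : IntegrableOn p (Icc 0 S)) (heti : IntegrableOn et (Icc 0 S))
    (hmp : ∀ s ∈ Icc 0 S, m s = ∫ x in (0 : ℝ)..s, p x)
    (hae : ∀ᵐ s ∂(volume.restrict (Icc 0 S)), 0 ≤ et s ∧ p s ^ 2 ≤ 4 * m s * et s) :
    ∀ x ∈ Icc 0 τ, m x ≤ 4 * τ * ∫ s in (0 : ℝ)..τ, et s := by
  obtain ⟨z, hz, hzmax⟩ := (isCompact_Icc : IsCompact (Icc (0 : ℝ) τ)).exists_isMaxOn
    (nonempty_Icc.2 hτ.le) (hmc.mono (Icc_subset_Icc le_rfl hτS))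
  have hBmax : ∀ x ∈ Icc 0 τ, m x ≤ m z := isMaxOn_iff.1 hzmax
  have hzS : z ∈ Icc 0 S := ⟨hz.1, hz.2.trans hτS⟩
  have hK_ae : 0 ≤ᵐ[volume.restrict (Ioc 0 τ)] et := by
    filter_upwards [ae_restrict_of_ae_restrict_of_subset
      (Ioc_subset_Icc_self.trans (Icc_subset_Icc le_rfl hτS)) hae] with s hs using hs.1
  have hii : ∀ {f : ℝ → ℝ} {a b : ℝ}, IntegrableOn f (Icc 0 S) → 0 ≤ a → a ≤ b → b ≤ S →
      IntervalIntegrable f volume a b := @fun f a b hf ha hab hb =>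
    (hf.mono_set (by rw [uIcc_of_le hab]; exact Icc_subset_Icc ha hb)).intervalIntegrable
  have hiz := hii heti le_rfl hz.1 hzS.2
  have h1 : m z ≤ z * (m z / (2 * τ)) + 2 * τ * ∫ s in (0 : ℝ)..z, et s := by
    calc m z = ∫ s in (0 : ℝ)..z, p s := hmp z hzS
      _ ≤ ∫ s in (0 : ℝ)..z, (m z / (2 * τ) + 2 * τ * et s) := by
          refine integral_mono_ae_restrict hz.1
            (hii hpi le_rfl hz.1 hzS.2)
            (intervalIntegrable_const.add (hiz.const_mul _)) ?_
          filter_upwards [ae_restrict_of_ae_restrict_of_subset (Icc_subset_Icc le_rfl hzS.2) hae,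
            ae_restrict_mem measurableSet_Icc] with s hs hsm
          have hms : 0 ≤ m s := hmnn s ⟨hsm.1, hsm.2.trans hzS.2⟩
          have hp := abs_le_div_add_mul_of_sq_le hms hs.1 (by positivity : (0 : ℝ) < 2 * τ) hs.2
          have hmz : m s / (2 * τ) ≤ m z / (2 * τ) :=
            div_le_div_of_nonneg_right (hBmax s ⟨hsm.1, hsm.2.trans hz.2⟩) (by positivity)
          linarith [le_abs_self (p s)]
      _ = z * (m z / (2 * τ)) + 2 * τ * ∫ s in (0 : ℝ)..z, et s := by
          rw [integral_add intervalIntegrable_const (hiz.const_mul _),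
            intervalIntegral.integral_const, intervalIntegral.integral_const_mul, smul_eq_mul,
            sub_zero]
  have h2 : ∫ s in (0 : ℝ)..z, et s ≤ ∫ s in (0 : ℝ)..τ, et s :=
    integral_mono_interval le_rfl hz.1 hz.2 hK_ae (hii heti le_rfl hτ.le hτS)
  have h3 : z * (m z / (2 * τ)) ≤ m z / 2 :=
    calc z * (m z / (2 * τ)) ≤ τ * (m z / (2 * τ)) :=
          mul_le_mul_of_nonneg_right hz.2 (div_nonneg (hmnn z hzS) (by positivity))
      _ = m z / 2 := by field_simp
  have h4 : 2 * τ * ∫ s in (0 : ℝ)..z, et s ≤ 2 * τ * ∫ s in (0 : ℝ)..τ, et s :=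
    mul_le_mul_of_nonneg_left h2 (by positivity)
  intro x hx
  have h5 := hBmax x hx
  linarith

/-- **`stub_fullSliceEnergy1D`** (pure one-dimensional real analysis). Wall at `s = 0`, box up
to `S ≥ s₁ > 0`; marginal mass `m ≥ 0` (continuous on `[0, S]`, `m 0 = 0`, `m = ∫₀ p`), normal
slice kinetic energy `et ≥ 0` and full slice energy `e ≥ et` (integrable on `[0, S]`) with
`p² ≤ 4 m·et` a.e., the local virial identity `∫₀^S g e + ½ ∫₀^S g' p = E' ∫₀^S g m` for every
`C¹` test function `g` (`E' ≥ 0`), and the linear bound `∫₀^σ et ≤ A σ` for `0 < σ ≤ s₁`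
(`A ≥ 0`). Then `∫₀^σ e ≤ 12 A σ + 32 E' A σ³` for every `σ > 0` with `2σ ≤ s₁`.
Proof: test the virial identity with the `C¹` ramp `θ` (`1` on `[0, σ]`, `0` beyond `2σ`,
`|θ'| ≤ π/(2σ)`), so `∫₀^σ e ≤ E' ∫₀^S θ m - ½ ∫₀^S θ' p`; bound `m ≤ 8σ ∫₀^{2σ} et ≤ 16 A σ²` on
`[0, 2σ]` (`marginalMass_le`) and `|p| ≤ m/(4σ) + 4σ·et` (`abs_le_div_add_mul_of_sq_le`). -/
theorem stub_fullSliceEnergy1D : ∀ (S E' A s₁ : ℝ) (m p et e : ℝ → ℝ), 0 ≤ E' → 0 ≤ A →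
    0 < s₁ → s₁ ≤ S → ContinuousOn m (Set.Icc 0 S) → m 0 = 0 → (∀ s ∈ Set.Icc 0 S, 0 ≤ m s) →
    MeasureTheory.IntegrableOn p (Set.Icc 0 S) → MeasureTheory.IntegrableOn et (Set.Icc 0 S) →
    MeasureTheory.IntegrableOn e (Set.Icc 0 S) →
    (∀ s ∈ Set.Icc 0 S, m s = ∫ x in (0 : ℝ)..s, p x) →
    (∀ᵐ s ∂(MeasureTheory.volume.restrict (Set.Icc 0 S)),
      0 ≤ et s ∧ et s ≤ e s ∧ p s ^ 2 ≤ 4 * m s * et s) →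
    (∀ g : ℝ → ℝ, ContDiff ℝ 1 g →
      (∫ s in (0 : ℝ)..S, g s * e s) + (1 / 2) * (∫ s in (0 : ℝ)..S, deriv g s * p s) =
        E' * ∫ s in (0 : ℝ)..S, g s * m s) →
    (∀ σ : ℝ, 0 < σ → σ ≤ s₁ → (∫ s in (0 : ℝ)..σ, et s) ≤ A * σ) →
    ∀ σ : ℝ, 0 < σ → 2 * σ ≤ s₁ →
      (∫ s in (0 : ℝ)..σ, e s) ≤ 12 * A * σ + 32 * E' * A * σ ^ 3 := by
  intro S E' A s₁ m p et e hE' hA _hs₁ hs₁S hmc _hm0 hmnn hpi heti hei hmp hae hvir hlin σ hσ h2σ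
  have h2σS : 2 * σ ≤ S := h2σ.trans hs₁S
  have hσS : σ ≤ S := by linarith
  have hσ2 : σ ≤ 2 * σ := by linarith
  have h2σ0 : 0 < 2 * σ := by positivity
  have hii : ∀ {f : ℝ → ℝ} {a b : ℝ}, IntegrableOn f (Icc 0 S) → 0 ≤ a → a ≤ b → b ≤ S →
      IntervalIntegrable f volume a b := @fun f a b hf ha hab hb =>
    (hf.mono_set (by rw [uIcc_of_le hab]; exact Icc_subset_Icc ha hb)).intervalIntegrable
  -- the normal kinetic energy within `2σ` of the wall and the mass bound on `[0, 2σ]`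
  have hK : (∫ s in (0 : ℝ)..(2 * σ), et s) ≤ A * (2 * σ) := hlin (2 * σ) h2σ0 h2σ
  obtain ⟨K, hKdef⟩ : ∃ K : ℝ, K = ∫ s in (0 : ℝ)..(2 * σ), et s := ⟨_, rfl⟩
  rw [← hKdef] at hK
  obtain ⟨B, hBdef⟩ : ∃ B : ℝ, B = 4 * (2 * σ) * K := ⟨_, rfl⟩
  have hB : ∀ x ∈ Icc 0 (2 * σ), m x ≤ B := by
    rw [hBdef, hKdef]
    exact marginalMass_le h2σ0 h2σS hmc hmnn hpi heti hmp (hae.mono fun s hs => ⟨hs.1, hs.2.2⟩)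
  -- the ramp and the virial identity tested against it
  obtain ⟨θ, hθC, hθ01, hθd, hθd0, hθ1, hθ0⟩ := exists_ramp hσ
  have hθc : Continuous θ := hθC.continuous
  have hθ'c : Continuous (deriv θ) := hθC.continuous_deriv le_rfl
  have hmi : IntegrableOn m (Icc 0 S) := hmc.integrableOn_compact isCompact_Icc
  have hθe : IntegrableOn (fun s => θ s * e s) (Icc 0 S) :=
    IntegrableOn.continuousOn_mul hθc.continuousOn hei isCompact_Icc
  have hθm : IntegrableOn (fun s => θ s * m s) (Icc 0 S) :=
    IntegrableOn.continuousOn_mul hθc.continuousOn hmi isCompact_Icc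
  have hθ'p : IntegrableOn (fun s => deriv θ s * p s) (Icc 0 S) :=
    IntegrableOn.continuousOn_mul hθ'c.continuousOn hpi isCompact_Icc
  have key := hvir θ hθC
  -- (a) `∫₀^σ e ≤ ∫₀^S θ e`
  have ha : (∫ s in (0 : ℝ)..σ, e s) ≤ ∫ s in (0 : ℝ)..S, θ s * e s := by
    rw [← integral_add_adjacent_intervals
      (hii hθe le_rfl hσ.le hσS)
      (hii hθe hσ.le hσS le_rfl)]
    have h1 : ∫ s in (0 : ℝ)..σ, θ s * e s = ∫ s in (0 : ℝ)..σ, e s := by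
      refine integral_congr fun x hx => ?_
      rw [uIcc_of_le hσ.le] at hx
      simp [hθ1 x hx.2]
    have h2 : 0 ≤ ∫ s in σ..S, θ s * e s := by
      refine integral_nonneg_of_ae_restrict hσS ?_
      filter_upwards [ae_restrict_of_ae_restrict_of_subset (Icc_subset_Icc hσ.le le_rfl) hae]
        with x hx
      exact mul_nonneg (hθ01 x).1 (hx.1.trans hx.2.1)
    rw [h1]
    linarith
  -- (b) the mass term `∫₀^S θ m ≤ 2σ B`
  have hb : (∫ s in (0 : ℝ)..S, θ s * m s) ≤ 2 * σ * B := by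
    rw [← integral_add_adjacent_intervals
      (hii hθm le_rfl h2σ0.le h2σS)
      (hii hθm h2σ0.le h2σS le_rfl)]
    have h1 : ∫ s in (2 * σ)..S, θ s * m s = 0 := by
      rw [integral_congr (g := fun _ => (0 : ℝ)) fun x hx => ?_, intervalIntegral.integral_zero]
      rw [uIcc_of_le h2σS] at hx
      simp [hθ0 x hx.1]
    have h2 : (∫ s in (0 : ℝ)..(2 * σ), θ s * m s) ≤ ∫ _ in (0 : ℝ)..(2 * σ), B := by
      refine integral_mono_on h2σ0.le
        (hii hθm le_rfl h2σ0.le h2σS)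
        intervalIntegrable_const fun x hx => ?_
      have hmx : 0 ≤ m x := hmnn x ⟨hx.1, hx.2.trans h2σS⟩
      calc θ x * m x ≤ 1 * m x := mul_le_mul_of_nonneg_right (hθ01 x).2 hmx
        _ = m x := one_mul _
        _ ≤ B := hB x hx
    rw [intervalIntegral.integral_const, smul_eq_mul, sub_zero] at h2
    linarith
  -- (c) the flux term `-∫₀^S θ' p ≤ (π/(2σ)) (σ B/(4σ) + 4σ K)`
  have hc : -(∫ s in (0 : ℝ)..S, deriv θ s * p s) ≤
      π / (2 * σ) * ((2 * σ - σ) * (B / (4 * σ)) + 4 * σ * K) := by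
    have h1 : (∫ s in (0 : ℝ)..S, deriv θ s * p s) = ∫ s in σ..(2 * σ), deriv θ s * p s :=
      MarginalSturm.integral_eq_integral_of_forall_not_mem_Ioo hσ.le hσ2 h2σS fun x hx => by
        rw [hθd0 x hx, zero_mul]
    have hiσ := hii heti hσ.le hσ2 h2σS
    have h2 : (∫ s in σ..(2 * σ), -(π / (2 * σ) * (B / (4 * σ) + 4 * σ * et s))) ≤
        ∫ s in σ..(2 * σ), deriv θ s * p s := by
      refine integral_mono_ae_restrict hσ2
        ((intervalIntegrable_const.add (hiσ.const_mul _)).const_mul _).neg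
        (hii hθ'p hσ.le hσ2 h2σS) ?_
      filter_upwards [ae_restrict_of_ae_restrict_of_subset (Icc_subset_Icc hσ.le h2σS) hae,
        ae_restrict_mem measurableSet_Icc] with s hs hsm
      have hms : 0 ≤ m s := hmnn s ⟨hσ.le.trans hsm.1, hsm.2.trans h2σS⟩
      have hp : |p s| ≤ m s / (4 * σ) + 4 * σ * et s :=
        abs_le_div_add_mul_of_sq_le hms hs.1 (by positivity) hs.2.2
      have hmsB : m s / (4 * σ) ≤ B / (4 * σ) :=
        div_le_div_of_nonneg_right (hB s ⟨hσ.le.trans hsm.1, hsm.2⟩) (by positivity)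
      have h3 : |deriv θ s * p s| ≤ π / (2 * σ) * (B / (4 * σ) + 4 * σ * et s) := by
        rw [abs_mul]
        exact mul_le_mul (hθd s) (by linarith) (abs_nonneg _) (by positivity)
      linarith [neg_abs_le (deriv θ s * p s)]
    have h3 : (∫ s in σ..(2 * σ), -(π / (2 * σ) * (B / (4 * σ) + 4 * σ * et s))) =
        -(π / (2 * σ) * ((2 * σ - σ) * (B / (4 * σ)) + 4 * σ * ∫ s in σ..(2 * σ), et s)) := by
      rw [intervalIntegral.integral_neg, intervalIntegral.integral_const_mul,
        intervalIntegral.integral_add intervalIntegrable_const (hiσ.const_mul _),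
        intervalIntegral.integral_const, intervalIntegral.integral_const_mul, smul_eq_mul]
    have h4 : (∫ s in σ..(2 * σ), et s) ≤ K := by
      rw [hKdef]
      refine integral_mono_interval hσ.le hσ2 le_rfl ?_
        (hii heti le_rfl h2σ0.le h2σS)
      filter_upwards [ae_restrict_of_ae_restrict_of_subset
        (Ioc_subset_Icc_self.trans (Icc_subset_Icc le_rfl h2σS)) hae] with s hs using hs.1
    have h5 : π / (2 * σ) * ((2 * σ - σ) * (B / (4 * σ)) + 4 * σ * ∫ s in σ..(2 * σ), et s) ≤
        π / (2 * σ) * ((2 * σ - σ) * (B / (4 * σ)) + 4 * σ * K) := by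
      have hπσ : 0 ≤ π / (2 * σ) := by positivity
      have h4' : 4 * σ * (∫ s in σ..(2 * σ), et s) ≤ 4 * σ * K :=
        mul_le_mul_of_nonneg_left h4 (by positivity)
      exact mul_le_mul_of_nonneg_left (by linarith) hπσ
    rw [h1]
    linarith
  -- (d) combine
  have hid : π / (2 * σ) * ((2 * σ - σ) * (B / (4 * σ)) + 4 * σ * K) = 3 * π * K := by
    rw [hBdef]
    field_simp
    ring
  rw [hid] at hc
  have e1 : E' * (∫ s in (0 : ℝ)..S, θ s * m s) ≤ E' * (2 * σ * B) :=
    mul_le_mul_of_nonneg_left hb hE'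
  have e2 : E' * (2 * σ * B) ≤ E' * (2 * σ * (4 * (2 * σ) * (A * (2 * σ)))) := by
    rw [hBdef]
    gcongr
  have e3 : 3 * π * K ≤ 3 * π * (A * (2 * σ)) := by gcongr
  have e4 : 3 * π * (A * (2 * σ)) ≤ 3 * 4 * (A * (2 * σ)) := by gcongr; exact pi_le_four
  nlinarith [key, ha, hc, e1, e2, e3, e4]

end Summit.AtomisticToContinuum.BoseEinsteinCondensation.Theorems.RigidMomentumBound

end
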